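import Literature.Computability.Complexity.AverageCaseDepthHierarchyCollapse
import Literature.Computability.Complexity.AverageCaseDepthHierarchyBlockProbs
import HarnessLib

/-!
# The Rossman–Servedio–Tan argument assembled (generic parameters)

B. Rossman, R. A. Servedio, L.-Y. Tan, *An average-case depth hierarchy theorem for Boolean
circuits*, arXiv:1504.03398 [RossmanServedioTan2015], §11.2 (pp. 37–38, proof of the first main
lower bound, Theorem 6, of which Theorem 1 is the bottom-fan-in-1 case): combine the completion
to uniform (Prop. 1), "what happens to the target" (Prop. 12), the collapse of the approximator
(Theorem 9 via Lemma 8 and union bounds), typicality (Props. 10–11) and the expected bias of the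
projected target (Prop. 13) with Prop. 14:
`Pr[Sipser_d(X) ≠ C(X)] ≥ E[bias] - r t₁ - Pr[not a depth-r DT] ≥ 1/2 - …`.

This file proves that chain of inequalities ONCE, by induction along the backward recursion
`ProcParams.V` of the process, for ARBITRARY parameters: the numerical inputs (per-stage failure
probabilities of the projection switching lemma and of typicality, the final bias) enter as
hypotheses `hpsl`, `htyp`, `hbase` on abstract typicality predicates `Typ j`, and the output is
`ProcParams.V_ge` : `V j τ (Sipser^{(j+1)} ↾ τ) (C ∘ E) ≥ 1/2 - ε₀ - s·t - Σ_{i<j} (δtyp i + |C| δpsl (i+1))`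
whenever `τ` is typical and every wire of `C` of height `≤ jtop - j` has, through the input map
`E`, a decision tree of depth `≤ dep j` over the current variables. The sibling file on Theorem 1
supplies RST's parameters and discharges the hypotheses.
-/

noncomputable section

namespace Literature.Computability.Complexity

namespace RSTProj

open Finset GateList

namespace ProcParams

variable (P : ProcParams) (o : ℕ → Bool)

/-- The target seen at stage `j` under the restriction `τ` of the level-`(j+1)` variables:
`Sipser^{(j+1)} ↾ τ` (RST Prop. 12: this is what `Ψ` makes of `Sipser_d`). [cite: RossmanServedioTan2015, §10.2 Prop. 12 (p. 35)] -/
def tgt (j : ℕ) (τ : BRestr (Blk P.W j) (Fin (P.W j))) (x : Blk P.W j × Fin (P.W j) → Bool) : Bool :=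
  sipserK (W := P.W) o (j + 1) (ovw τ x)

/-- On the support of `R(τ)` the drawn restriction refines `τ` blockwise. [cite: RossmanServedioTan2015, §7.2 Def. 9 (p. 18)] -/
theorem refines_of_R_ne_zero {L : BlockLaw} {A : Type*} [Fintype A] [DecidableEq A] {w : ℕ}
    {τ ρ : BRestr A (Fin w)} (h : L.R τ ρ ≠ 0) (a : A) : Refines (ρ a) (τ a) := by
  classical
  refine L.refines_of_ζ_ne_zero fun h0 => h ?_
  exact Finset.prod_eq_zero (Finset.mem_univ a) h0

/-- Overwriting by `τ` an input expanded from a refinement of `τ` does nothing. [folklore] -/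
theorem ovw_expand_of_refines {j : ℕ} {τ ρ : BRestr (Blk P.W j) (Fin (P.W j))}
    (href : ∀ a, Refines (ρ a) (τ a)) (x : Blk P.W j → Bool) :
    ovw τ (BRestr.expand ρ x) = BRestr.expand ρ x := by
  funext v
  simp only [ovw, BRestr.expand]
  cases hτ : τ v.1 v.2 with
  | none => rfl
  | some b =>
    have := href v.1 v.2 (by rw [hτ]; exact Option.some_ne_none b)
    rw [this, hτ]; rfl

/-- **What happens to the target** (RST Fact 8 / Prop. 12, one stage): projecting
`Sipser^{(j+2)} ↾ τ` by a refinement `ρ` of `τ` gives `Sipser^{(j+1)} ↾ ρ̂`. [cite: RossmanServedioTan2015, §10.2 Fact 8 and Prop. 12 (pp. 34–35, eq. (31))] -/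
theorem tgt_expand {j : ℕ} (ho : (P.law (j + 1)).o = o (j + 1)) {τ ρ : BRestr (Blk P.W (j + 1)) (Fin (P.W (j + 1)))}
    (href : ∀ a, Refines (ρ a) (τ a)) :
    (fun x : Blk P.W j × Fin (P.W j) → Bool => P.tgt o (j + 1) τ (BRestr.expand ρ x)) =
      P.tgt o j (liftR (P.law (j + 1)).o ρ) := by
  funext x
  unfold tgt
  rw [P.ovw_expand_of_refines href, sipserK_expand, ho]
  rfl

/-- `V` is nonnegative. [folklore] -/
theorem V_nonneg (hR : ∀ j (τ ρ : BRestr (Blk P.W (j + 1)) (Fin (P.W (j + 1)))), 0 ≤ (P.law (j + 1)).R τ ρ)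
    (hpl : ∀ (τ : BRestr (Blk P.W 0) (Fin (P.W 0))) Z, 0 ≤ (P.law 0).plaw τ Z) :
    ∀ (j : ℕ) (τ : BRestr (Blk P.W j) (Fin (P.W j))) (F G : (Blk P.W j × Fin (P.W j) → Bool) → Bool), 0 ≤ P.V j τ F G
  | 0, τ, F, G => Finset.sum_nonneg fun Z _ => mul_nonneg (hpl τ Z) (by split_ifs <;> norm_num)
  | j + 1, τ, F, G => Finset.sum_nonneg fun ρ _ => mul_nonneg (hR j τ ρ) (V_nonneg hR hpl j _ _ _)

/-- The accumulated error after the stages `j, …, 1`: the final deficit `ε₀ + s t` plus, for each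
stage, the probability of losing typicality and the union bound over the gates for the projection
switching lemma. [cite: RossmanServedioTan2015, §11.2 (p. 37–38, the last display)] -/
def errTot (ε₀ st : ℝ) (δtyp δpsl : ℕ → ℝ) (ngates : ℕ) (j : ℕ) : ℝ :=
  ε₀ + st + ∑ i ∈ Finset.range j, (δtyp i + ngates * δpsl (i + 1))

/-- **RST's chain of inequalities, generic form.** Fix consistent process parameters with
polarities `o`, a straight-line circuit `gs` over `acBasis` with output wire `out` of height
`≤ jtop`, typicality predicates `Typ j` on the restrictions met at stage `j`, depth bounds `dep`
(`dep j = s ≥ 1` below the top stage) and numbers such that, at the stages `j < jtop`: (`hpsl`) at a typical `τ` of stage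
`j+1`, a DNF of width `≤ dep (j+1)` with repetition-free terms has canonical projection decision
tree deeper than `s` with `R(τ)`-probability `≤ δpsl (j+1)`; (`htyp`) typicality is lost with
probability `≤ δtyp j`; (`hbase`, `htyp0`) at a typical final `τ` no fixed child of the root is
controlling and the root gate is `ε₀`-balanced; the final star probability is `≤ t`. Then for every
`j ≤ jtop`, typical `τ` and input map `E` through which all wires of height `≤ jtop - j` have
decision trees of depth `≤ dep j`:
`V j τ (Sipser^{(j+1)}↾τ) (out ∘ E) ≥ 1/2 - ε₀ - s t - Σ_{i<j} (δtyp i + |gs| δpsl (i+1))`.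
[cite: RossmanServedioTan2015, §11.2 (pp. 37–38, proof of Theorem 6) with §9.6 Prop. 8 (p. 29) and §10.2 Prop. 13 (p. 36)] -/
theorem V_ge (hP : P.Consistent) (ho : ∀ j, (P.law j).o = o j)
    (hR : ∀ j (τ ρ : BRestr (Blk P.W (j + 1)) (Fin (P.W (j + 1)))), 0 ≤ (P.law (j + 1)).R τ ρ)
    {ι : Type*} {gs : List (Gate ι)} (hwf : WF gs) (hB : ∀ g ∈ gs, g.fn ∈ acBasis)
    {out : ι ⊕ ℕ} (hout : OutOK gs.length out) {jtop : ℕ} (hht : wireHt gs out ≤ jtop)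
    (Typ : (j : ℕ) → BRestr (Blk P.W j) (Fin (P.W j)) → Prop) [∀ j, DecidablePred (Typ j)]
    {s : ℕ} (dep : ℕ → ℕ) (hdep1 : ∀ j, 1 ≤ dep j) (hdeps : ∀ j, dep j ≤ s)
    (hdep : ∀ j, j < jtop → dep j = s)
    {δtyp δpsl : ℕ → ℝ} (hδtyp : ∀ i, 0 ≤ δtyp i) (hδpsl : ∀ i, 0 ≤ δpsl i) {ε₀ t : ℝ} (hε₀ : 0 ≤ ε₀)
    (ht0 : 0 ≤ t)
    (hpsl : ∀ j (τ : BRestr (Blk P.W (j + 1)) (Fin (P.W (j + 1)))), j < jtop → Typ (j + 1) τ →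
      ∀ F : CNF (Blk P.W (j + 1) × Fin (P.W (j + 1))), (∀ T ∈ F, VarNodup T) → (∀ T ∈ F, T.length ≤ dep (j + 1)) →
        ∑ ρ ∈ univ.filter (fun ρ => s + 1 ≤ pcdt F ρ), (P.law (j + 1)).R τ ρ ≤ δpsl (j + 1))
    (htyp : ∀ j (τ : BRestr (Blk P.W (j + 1)) (Fin (P.W (j + 1)))), j < jtop → Typ (j + 1) τ →
      ∑ ρ ∈ univ.filter (fun ρ => ¬ Typ j (liftR (P.law (j + 1)).o ρ)), (P.law (j + 1)).R τ ρ ≤ δtyp j)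
    (htyp0 : ∀ τ : BRestr (Blk P.W 0) (Fin (P.W 0)), Typ 0 τ → ∀ i c, τ default i = some c → c = o 0)
    (htfin : (P.law 0).t ≤ t)
    (hbase : ∀ τ : BRestr (Blk P.W 0) (Fin (P.W 0)), Typ 0 τ →
      1 / 2 - ε₀ ≤ min
        (∑ za : Fin (P.W 0) → Bool, prodLaw (fun i b => pw (P.law 0) (τ default i) b) za *
          (if gate (o 0) (fun i => (τ default i).getD (za i)) = o 0 then 1 else 0))
        (∑ za : Fin (P.W 0) → Bool, prodLaw (fun i b => pw (P.law 0) (τ default i) b) za *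
          (if gate (o 0) (fun i => (τ default i).getD (za i)) = !o 0 then 1 else 0))) :
    ∀ j, j ≤ jtop → ∀ (τ : BRestr (Blk P.W j) (Fin (P.W j))) (E : (Blk P.W j × Fin (P.W j) → Bool) → (ι → Bool)),
      Typ j τ → InvE gs E (jtop - j) (dep j) →
        1 / 2 - errTot ε₀ (s * t) δtyp δpsl gs.length j ≤ P.V j τ (P.tgt o j τ) (fun x => wireFn gs out (E x)) := by
  classical
  have hpl : ∀ (τ : BRestr (Blk P.W 0) (Fin (P.W 0))) Z, 0 ≤ (P.law 0).plaw τ Z :=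
    fun τ Z => (P.law 0).plaw_nonneg (hP.t_pos 0).le (hP.t_le_one 0) τ Z
  intro j
  induction j with
  | zero =>
    intro _ τ E hτ hinv
    -- the output wire has a decision tree of depth `≤ s`
    have hgood : GoodWireE gs E s out := (hinv out hout (by simpa using hht)).mono (hdeps 0)
    obtain ⟨T, hT, hTe⟩ := hgood
    -- rewrite `V 0` as a sum over the single root block
    have hV : P.V 0 τ (P.tgt o 0 τ) (fun x => wireFn gs out (E x)) =
        ∑ za : Fin (P.W 0) → Bool, prodLaw (fun i b => pw (P.law 0) (τ default i) b) za *
          (if gate (o 0) (fun i => (τ default i).getD (za i)) = T.eval (fun v => za v.2) then 0 else 1) := by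
      show ∑ Z : Blk P.W 0 → Fin (P.W 0) → Bool, (P.law 0).plaw τ Z *
          (if P.tgt o 0 τ (fun v => Z v.1 v.2) = wireFn gs out (E fun v => Z v.1 v.2) then 0 else 1) = _
      rw [← (Equiv.funUnique (Blk P.W 0) (Fin (P.W 0) → Bool)).symm.sum_comp]
      refine Finset.sum_congr rfl fun za _ => ?_
      have hZ : ((Equiv.funUnique (Blk P.W 0) (Fin (P.W 0) → Bool)).symm za) = fun _ => za := rfl
      rw [hZ]
      congr 1
      · rw [P.plaw_eq_prod_pw, prodLaw]
        exact Fintype.prod_unique _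
      · have e1 : P.tgt o 0 τ (fun v : Blk P.W 0 × Fin (P.W 0) => za v.2) = gate (o 0) (fun i => (τ default i).getD (za i)) := rfl
        have e2 : wireFn gs out (E fun v : Blk P.W 0 × Fin (P.W 0) => za v.2) = T.eval (fun v => za v.2) := (hTe _).symm
        simp only [e1, e2]
    rw [hV, errTot, Finset.range_zero, Finset.sum_empty, add_zero]
    have hp : ∀ i, ∑ b : Bool, pw (P.law 0) (τ default i) b = 1 := by
      intro i; unfold pw
      cases τ default i with
      | none => rw [Fintype.sum_bool]; cases hoo : (P.law 0).o <;> simp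
      | some c => rw [Fintype.sum_bool]; cases c <;> simp
    have hp0 : ∀ i b, 0 ≤ pw (P.law 0) (τ default i) b := by
      intro i b; unfold pw
      cases τ default i with
      | none =>
        have := hP.t_pos 0; have := hP.t_le_one 0
        simp only; split_ifs <;> linarith
      | some c => simp only; split_ifs <;> norm_num
    have hsupp : ∀ (za : Fin (P.W 0) → Bool) i c, 0 < prodLaw (fun i b => pw (P.law 0) (τ default i) b) za →
        τ default i = some c → za i = c := by
      intro za i c hpos hτ
      by_contra hne
      have : prodLaw (fun i b => pw (P.law 0) (τ default i) b) za = 0 :=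
        Finset.prod_eq_zero (Finset.mem_univ i) (by simp only [pw, hτ, if_neg hne])
      rw [this] at hpos; exact lt_irrefl _ hpos
    have hmarg : ∀ i, pw (P.law 0) (τ default i) (!o 0) ≤ t := by
      intro i; unfold pw
      cases hτi : τ default i with
      | none =>
        simp only [ho 0]
        rw [if_neg (Bool.not_ne_self (o 0))]; exact htfin
      | some c =>
        have hc := htyp0 τ hτ i c hτi
        simp only
        rw [if_neg]; · exact ht0
        rw [hc]; exact Bool.not_ne_self (o 0)
    have h14 : min
        (∑ za : Fin (P.W 0) → Bool, prodLaw (fun i b => pw (P.law 0) (τ default i) b) za *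
          (if gate (o 0) (fun i => (τ default i).getD (za i)) = o 0 then 1 else 0))
        (∑ za : Fin (P.W 0) → Bool, prodLaw (fun i b => pw (P.law 0) (τ default i) b) za *
          (if gate (o 0) (fun i => (τ default i).getD (za i)) = !o 0 then 1 else 0)) - s * t ≤
        ∑ za : Fin (P.W 0) → Bool, prodLaw (fun i b => pw (P.law 0) (τ default i) b) za *
          (if gate (o 0) (fun i => (τ default i).getD (za i)) = T.eval (fun v => za v.2) then 0 else 1) :=
      disagree_ge_bias (o 0) (fun i b => pw (P.law 0) (τ default i) b) hp hp0 (τ default) hsupp ht0 hmarg T hT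
    have hb := hbase τ hτ
    linarith
  | succ j ih =>
    intro hj τ E hτ hinv
    have hjlt : j < jtop := Nat.lt_of_succ_le hj
    set L := P.law (j + 1) with hL
    -- the good restrictions of this stage
    let badT : BRestr (Blk P.W (j + 1)) (Fin (P.W (j + 1))) → Prop := fun ρ => ¬ Typ j (liftR L.o ρ)
    let gatesTop : Finset ℕ := (Finset.range gs.length).filter fun g =>
      ∃ hg : g < gs.length, wireHt gs (.inr g) = (jtop - (j + 1)) + 1 ∧ (gs[g]).fn ≠ GateFn.not
    let badG : ℕ → BRestr (Blk P.W (j + 1)) (Fin (P.W (j + 1))) → Prop := fun g ρ =>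
      ∃ hg : g < gs.length, s + 1 ≤ pcdt (gateDNFE gs E (dep (j + 1)) gs[g]) ρ
    let good : BRestr (Blk P.W (j + 1)) (Fin (P.W (j + 1))) → Prop := fun ρ =>
      ¬ badT ρ ∧ ¬ ∃ g ∈ gatesTop, badG g ρ
    -- on a good restriction of positive weight, the induction hypothesis applies
    have hIH : ∀ ρ, good ρ → L.R τ ρ ≠ 0 →
        1 / 2 - errTot ε₀ (s * t) δtyp δpsl gs.length j ≤
          P.V j (liftR L.o ρ) (fun x : Blk P.W j × Fin (P.W j) → Bool => P.tgt o (j + 1) τ (BRestr.expand ρ x))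
            (fun x : Blk P.W j × Fin (P.W j) → Bool => wireFn gs out (E (BRestr.expand ρ x))) := by
      intro ρ hgood hne
      have href : ∀ a, Refines (ρ a) (τ a) := fun a => refines_of_R_ne_zero hne a
      rw [P.tgt_expand o (ho (j + 1)) href]
      refine ih hjlt.le (liftR L.o ρ) (fun y => E (BRestr.expand ρ y)) (not_not.1 hgood.1) ?_
      -- the invariant moves up one level
      have hstep := invE_project hwf hB (hdep1 (j + 1)) (hdeps (j + 1)) hinv ρ (fun g hg hgt hnot => by
        by_contra hlt
        push Not at hlt
        exact hgood.2 ⟨g, Finset.mem_filter.2 ⟨Finset.mem_range.2 hg, hg, hgt, hnot⟩, hg, hlt⟩)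
      have e : jtop - (j + 1) + 1 = jtop - j := by omega
      rw [e] at hstep
      rw [hdep j hjlt]
      exact hstep
    -- weights
    have hR0 : ∀ ρ, 0 ≤ L.R τ ρ := hR j τ
    have hsum : ∑ ρ, L.R τ ρ = 1 := L.sum_R (hP.t_pos _) (hP.t_le_one _) τ
    have hV0 : ∀ ρ, 0 ≤ P.V j (liftR L.o ρ) (fun x : Blk P.W j × Fin (P.W j) → Bool => P.tgt o (j + 1) τ (BRestr.expand ρ x))
        (fun x : Blk P.W j × Fin (P.W j) → Bool => wireFn gs out (E (BRestr.expand ρ x))) :=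
      fun ρ => P.V_nonneg hR hpl j _ _ _
    -- the bad weight
    have hbadT : ∑ ρ ∈ univ.filter badT, L.R τ ρ ≤ δtyp j := htyp j τ hjlt hτ
    have hbadG : ∑ ρ ∈ univ.filter (fun ρ => ∃ g ∈ gatesTop, badG g ρ), L.R τ ρ ≤ gs.length * δpsl (j + 1) := by
      refine (weight_exists_le (L.R τ) hR0 gatesTop badG).trans ?_
      have hg1 : ∀ g ∈ gatesTop, ∑ ρ ∈ univ.filter (fun ρ => badG g ρ), L.R τ ρ ≤ δpsl (j + 1) := by
        intro g hg
        obtain ⟨_, hglt, _, _⟩ := Finset.mem_filter.1 hg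
        have hF := gateDNFE_wf (gs := gs) E (dep (j + 1)) gs[g]
        have := hpsl j τ hjlt hτ (gateDNFE gs E (dep (j + 1)) gs[g]) (fun T hT => (hF T hT).1) (fun T hT => (hF T hT).2)
        refine le_trans (le_of_eq (Finset.sum_congr ?_ fun _ _ => rfl)) this
        ext ρ; simp [badG, hglt]
      calc ∑ g ∈ gatesTop, ∑ ρ ∈ univ.filter (fun ρ => badG g ρ), L.R τ ρ
          ≤ ∑ g ∈ gatesTop, δpsl (j + 1) := Finset.sum_le_sum hg1
        _ = gatesTop.card * δpsl (j + 1) := by rw [Finset.sum_const, nsmul_eq_mul]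
        _ ≤ gs.length * δpsl (j + 1) := by
            refine mul_le_mul_of_nonneg_right ?_ (hδpsl _)
            exact_mod_cast (Finset.card_filter_le _ _).trans (by rw [Finset.card_range])
    have hbad : ∑ ρ ∈ univ.filter (fun ρ => ¬ good ρ), L.R τ ρ ≤ δtyp j + gs.length * δpsl (j + 1) := by
      have hsub : univ.filter (fun ρ => ¬ good ρ) ⊆ univ.filter badT ∪ univ.filter (fun ρ => ∃ g ∈ gatesTop, badG g ρ) := by
        intro ρ hρ
        simp only [Finset.mem_filter, Finset.mem_univ, true_and, good, not_and_or, not_not] at hρ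
        rw [Finset.mem_union, Finset.mem_filter, Finset.mem_filter]
        rcases hρ with h | h
        · exact Or.inl ⟨Finset.mem_univ _, h⟩
        · exact Or.inr ⟨Finset.mem_univ _, h⟩
      calc ∑ ρ ∈ univ.filter (fun ρ => ¬ good ρ), L.R τ ρ
          ≤ ∑ ρ ∈ univ.filter badT ∪ univ.filter (fun ρ => ∃ g ∈ gatesTop, badG g ρ), L.R τ ρ :=
            Finset.sum_le_sum_of_subset_of_nonneg hsub fun ρ _ _ => hR0 ρ
        _ ≤ ∑ ρ ∈ univ.filter badT, L.R τ ρ + ∑ ρ ∈ univ.filter (fun ρ => ∃ g ∈ gatesTop, badG g ρ), L.R τ ρ := by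
            rw [← Finset.sum_union_inter]
            have : 0 ≤ ∑ ρ ∈ univ.filter badT ∩ univ.filter (fun ρ => ∃ g ∈ gatesTop, badG g ρ), L.R τ ρ :=
              Finset.sum_nonneg fun ρ _ => hR0 ρ
            linarith
        _ ≤ _ := add_le_add hbadT hbadG
    -- the main estimate
    have hgoodsum : 1 - (δtyp j + gs.length * δpsl (j + 1)) ≤ ∑ ρ ∈ univ.filter good, L.R τ ρ := by
      have := Finset.sum_filter_add_sum_filter_not univ good (L.R τ)
      rw [hsum] at this
      linarith
    set c := 1 / 2 - errTot ε₀ (s * t) δtyp δpsl gs.length j with hc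
    have herr : errTot ε₀ (s * t) δtyp δpsl gs.length (j + 1) =
        errTot ε₀ (s * t) δtyp δpsl gs.length j + (δtyp j + gs.length * δpsl (j + 1)) := by
      simp [errTot, Finset.sum_range_succ]; ring
    show 1 / 2 - errTot ε₀ (s * t) δtyp δpsl gs.length (j + 1) ≤
      ∑ ρ, L.R τ ρ * P.V j (liftR L.o ρ) (fun x : Blk P.W j × Fin (P.W j) → Bool => P.tgt o (j + 1) τ (BRestr.expand ρ x))
        (fun x : Blk P.W j × Fin (P.W j) → Bool => wireFn gs out (E (BRestr.expand ρ x)))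
    rw [herr]
    have hβ : 0 ≤ δtyp j + gs.length * δpsl (j + 1) :=
      add_nonneg (hδtyp j) (mul_nonneg (Nat.cast_nonneg _) (hδpsl _))
    by_cases hcneg : c ≤ 0
    · calc 1 / 2 - (errTot ε₀ (s * t) δtyp δpsl gs.length j + (δtyp j + gs.length * δpsl (j + 1)))
          ≤ c := by rw [hc]; linarith
        _ ≤ 0 := hcneg
        _ ≤ _ := Finset.sum_nonneg fun ρ _ => mul_nonneg (hR0 ρ) (hV0 ρ)
    · push Not at hcneg
      have hc1 : c ≤ 1 := by
        rw [hc, errTot]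
        have h1 : 0 ≤ ∑ i ∈ Finset.range j, (δtyp i + gs.length * δpsl (i + 1)) :=
          Finset.sum_nonneg fun i _ => add_nonneg (hδtyp i) (mul_nonneg (Nat.cast_nonneg _) (hδpsl _))
        have h2 : 0 ≤ (s : ℝ) * t := mul_nonneg (Nat.cast_nonneg s) ht0
        linarith
      calc 1 / 2 - (errTot ε₀ (s * t) δtyp δpsl gs.length j + (δtyp j + gs.length * δpsl (j + 1)))
          = c - (δtyp j + gs.length * δpsl (j + 1)) := by rw [hc]; ring
        _ ≤ c * (1 - (δtyp j + gs.length * δpsl (j + 1))) := by nlinarith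
        _ ≤ c * ∑ ρ ∈ univ.filter good, L.R τ ρ := mul_le_mul_of_nonneg_left hgoodsum hcneg.le
        _ = ∑ ρ ∈ univ.filter good, c * L.R τ ρ := by rw [Finset.mul_sum]
        _ ≤ ∑ ρ ∈ univ.filter good, L.R τ ρ * P.V j (liftR L.o ρ)
              (fun x : Blk P.W j × Fin (P.W j) → Bool => P.tgt o (j + 1) τ (BRestr.expand ρ x))
              (fun x : Blk P.W j × Fin (P.W j) → Bool => wireFn gs out (E (BRestr.expand ρ x))) := by
            refine Finset.sum_le_sum fun ρ hρ => ?_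
            have hg : good ρ := (Finset.mem_filter.1 hρ).2
            by_cases hz : L.R τ ρ = 0
            · rw [hz]; simp
            · rw [mul_comm]
              exact mul_le_mul_of_nonneg_left (hIH ρ hg hz) (hR0 ρ)
        _ ≤ _ := Finset.sum_le_sum_of_subset_of_nonneg (Finset.filter_subset _ _)
              fun ρ _ _ => mul_nonneg (hR0 ρ) (hV0 ρ)

end ProcParams

/-! ### The bias of the root after the last stage (RST §10.2, eq. (14)) -/

/-- Under the product law whose coordinates are fixed to `o` or free with `P[o] = 1 - t`, the root
gate `gate o` outputs `o` with probability `(1-t)^{#free}`. [cite: RossmanServedioTan2015, §10.2 proof of Lemma 17 (p. 36, `bias ≤ max {Pr[Y_S = 0^S], Pr[Y_S ≠ 0^S]}`)] -/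
theorem sum_prodLaw_gate_eq (L : BlockLaw) {n : ℕ} (τ : Fin n → Option Bool) (hfix : ∀ i c, τ i = some c → c = L.o) :
    ∑ za : Fin n → Bool, prodLaw (fun i b => ProcParams.pw L (τ i) b) za *
        (if gate L.o (fun i => (τ i).getD (za i)) = L.o then 1 else 0) = (1 - L.t) ^ (stars τ).card := by
  classical
  -- the indicator of `gate = o` factorises over the coordinates
  have hind : ∀ za : Fin n → Bool, prodLaw (fun i b => ProcParams.pw L (τ i) b) za *
      (if gate L.o (fun i => (τ i).getD (za i)) = L.o then (1 : ℝ) else 0) =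
      ∏ i, (ProcParams.pw L (τ i) (za i) * (if (τ i).getD (za i) = L.o then (1 : ℝ) else 0)) := by
    intro za
    rw [Finset.prod_mul_distrib, prodLaw]
    congr 1
    by_cases h : ∀ i, (τ i).getD (za i) = L.o
    · rw [if_pos, Finset.prod_eq_one fun i _ => by rw [if_pos (h i)]]
      unfold gate; rw [if_neg]; push Not; intro i; rw [h i]; exact (Bool.not_ne_self L.o).symm
    · push Not at h
      obtain ⟨i, hi⟩ := h
      rw [if_neg, Finset.prod_eq_zero (Finset.mem_univ i) (by rw [if_neg hi])]
      unfold gate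
      rw [if_pos ⟨i, by cases hx : (τ i).getD (za i) <;> cases ho : L.o <;> simp_all⟩]
      exact Bool.not_ne_self L.o
  rw [Finset.sum_congr rfl fun za _ => hind za]
  have h := Finset.prod_univ_sum (fun (_ : Fin n) => (univ : Finset Bool))
    (fun i c => ProcParams.pw L (τ i) c * (if (τ i).getD c = L.o then (1 : ℝ) else 0))
  simp only [Fintype.piFinset_univ] at h
  rw [← h]
  -- each coordinate contributes `1 - t` (free) or `1` (fixed to `o`)
  have hfac : ∀ i, ∑ c : Bool, ProcParams.pw L (τ i) c * (if (τ i).getD c = L.o then (1 : ℝ) else 0) =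
      if τ i = none then 1 - L.t else 1 := by
    intro i
    cases hτ : τ i with
    | none =>
      simp only [ProcParams.pw, Option.getD_none, if_true]
      rw [Fintype.sum_bool]
      cases ho : L.o <;> simp
    | some c =>
      have hc := hfix i c hτ
      subst hc
      simp only [ProcParams.pw, Option.getD_some]
      rw [Fintype.sum_bool]
      cases ho : L.o <;> simp
  simp_rw [hfac]
  rw [Finset.prod_ite, Finset.prod_const, Finset.prod_const_one, mul_one]
  rfl

/-- **The bias at the root** (RST §10.2, from eq. (14)): if no child of the root is fixed to the
controlling value and the number of free children is in `[lo, hi]`, then both `P[root = o]` and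
`P[root = ¬o]` under the final product law are at least `1/2 - ε₀` as soon as
`(1-t)^{hi} ≥ 1/2 - ε₀` and `(1-t)^{lo} ≤ 1/2 + ε₀`. [cite: RossmanServedioTan2015, §10.2 proof of Lemma 17 (p. 36) with eq. (14) (p. 15)] -/
theorem base_bias (L : BlockLaw) (ht0 : 0 ≤ L.t) (ht1 : L.t < 1) {n : ℕ} (τ : Fin n → Option Bool)
    (hfix : ∀ i c, τ i = some c → c = L.o) {lo hi ε₀ : ℝ} (hlo : lo ≤ (stars τ).card) (hhi : ((stars τ).card : ℝ) ≤ hi)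
    (h1 : 1 / 2 - ε₀ ≤ (1 - L.t) ^ hi) (h2 : (1 - L.t) ^ lo ≤ 1 / 2 + ε₀) :
    1 / 2 - ε₀ ≤ min
      (∑ za : Fin n → Bool, prodLaw (fun i b => ProcParams.pw L (τ i) b) za * (if gate L.o (fun i => (τ i).getD (za i)) = L.o then 1 else 0))
      (∑ za : Fin n → Bool, prodLaw (fun i b => ProcParams.pw L (τ i) b) za * (if gate L.o (fun i => (τ i).getD (za i)) = !L.o then 1 else 0)) := by
  classical
  have hS := sum_prodLaw_gate_eq L τ hfix
  have hb0 : 0 < 1 - L.t := by linarith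
  have hb1 : 1 - L.t ≤ 1 := by linarith
  -- the complementary probability
  have hp1 : ∀ i, ∑ b : Bool, ProcParams.pw L (τ i) b = 1 := by
    intro i
    cases hτ : τ i with
    | none => simp only [ProcParams.pw]; rw [Fintype.sum_bool]; cases L.o <;> simp
    | some c => simp only [ProcParams.pw]; rw [Fintype.sum_bool]; cases c <;> simp
  have htot : ∑ za : Fin n → Bool, prodLaw (fun i b => ProcParams.pw L (τ i) b) za = 1 := by
    have h := Finset.prod_univ_sum (fun (_ : Fin n) => (univ : Finset Bool)) (fun i c => ProcParams.pw L (τ i) c)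
    simp only [Fintype.piFinset_univ] at h
    unfold prodLaw
    rw [← h, Finset.prod_eq_one fun i _ => hp1 i]
  have hS' : ∑ za : Fin n → Bool, prodLaw (fun i b => ProcParams.pw L (τ i) b) za *
      (if gate L.o (fun i => (τ i).getD (za i)) = !L.o then 1 else 0) = 1 - (1 - L.t) ^ (stars τ).card := by
    have e : ∑ za : Fin n → Bool, prodLaw (fun i b => ProcParams.pw L (τ i) b) za *
        (if gate L.o (fun i => (τ i).getD (za i)) = !L.o then (1 : ℝ) else 0) =
        ∑ za : Fin n → Bool, (prodLaw (fun i b => ProcParams.pw L (τ i) b) za -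
          prodLaw (fun i b => ProcParams.pw L (τ i) b) za * (if gate L.o (fun i => (τ i).getD (za i)) = L.o then (1 : ℝ) else 0)) := by
      refine Finset.sum_congr rfl fun za _ => ?_
      have : gate L.o (fun i => (τ i).getD (za i)) = L.o ∨ gate L.o (fun i => (τ i).getD (za i)) = !L.o := by
        cases gate L.o (fun i => (τ i).getD (za i)) <;> cases L.o <;> simp
      rcases this with h | h
      · rw [if_pos h, if_neg (by rw [h]; exact (Bool.not_ne_self L.o).symm)]; ring
      · rw [if_pos h, if_neg (by rw [h]; exact Bool.not_ne_self L.o)]; ring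
    rw [e, Finset.sum_sub_distrib, htot, hS]
  rw [hS, hS']
  -- monotonicity in the exponent
  have e : ((1 - L.t) ^ (stars τ).card : ℝ) = (1 - L.t) ^ ((stars τ).card : ℝ) := (Real.rpow_natCast _ _).symm
  have hup : (1 - L.t) ^ hi ≤ (1 - L.t) ^ ((stars τ).card : ℝ) :=
    Real.rpow_le_rpow_of_exponent_ge hb0 hb1 hhi
  have hdn : (1 - L.t) ^ ((stars τ).card : ℝ) ≤ (1 - L.t) ^ lo :=
    Real.rpow_le_rpow_of_exponent_ge hb0 hb1 hlo
  rw [e]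
  exact le_min (h1.trans hup) (by linarith)

end RSTProj

end Literature.Computability.Complexity

end
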